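import Mathlib

/-!
# `MatrixDescartes` (stmt-ValiantsHypothesis-18050, V1) — line «negsquares» ported: the GROSS-SUBSTITUTES ENGINE of T1
# (valuated matroids: under a weight raise on `S` the unique optimal base moves INTO `S`)

HONEST FRAMING.  Helper port (`--supports stmt-ValiantsHypothesis-18050 --as helper`; val-lit port pool, seat val-port-3 g0;
CLAIM-FIRST #5 on the val-lit bus) of §T1 (lines 81–214) of the crux workfile
`Cruxes/MatrixDescartes/Lines/negsquares_tropical.lean` (val-idea-6 g7, sha16 `29181cddc83b828e`; val-idea-crit-1 NOTE
#47/#48 READ, val-idea-crit-2 VERDICT #37 = PASS support tier: «T1/C1 CONFIRMED by own derivation + own code»), token-for-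
token up to the namespace (`…Theorems.LacunarySymmetroidMatrixDescartes.NegSquaresTropical`) and `import Mathlib` only.
Four small definitions (`IsValuation` — the Dress–Wenzel exchange axiom on a base family, `addW`, `IsUniqueArgmax`,
`raise`; review lane), no named facts, nothing admitted.  The located candidate `OneLawSharp` (§L1 of the workfile, a
CONJECTURE of the ideator seat) is deliberately NOT ported; §R1 is the sibling `…NegSquaresExtremeExponent`.  Pure
combinatorics: nothing here bears on the negsquares LAW (#36 PWP, 0 provers), on the crux
`…Theses.LacunarySymmetroid.MatrixDescartes`, on Conjecture B, or on `VP ≠ VNP` (NOT proved).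

CONTENTS.  ★ `upperSetMove` («Lemma A» of the line's memo `negsquares-tropical.md` §2): if `B` is the unique maximiser of
`v + c` over a valuated base family and `B'` the unique maximiser after the weights on `S` are raised by `δ > 0`, then
`B ∩ S ⊆ B'` and `B' \ S ⊆ B`; counting forms `card_mono_of_raise`, `card_inter_mono_of_nested_raise` (the per-step
statement of the memo's Theorem T1: along a `K`-slope direction a valuated matroid has `≤ (K−1)·rank` breakpoints).
[folklore] Dress–Wenzel valuated matroids / gross substitutes (Murota, *Discrete Convex Analysis*, ch. 5); texts val-idea-6 g7.
-/

-- `Summit.ValiantsHypothesis.ValiantsHypothesis.…` is the tree's mandated single-conjunct layout (Sub = Summit).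
set_option linter.dupNamespace false

namespace Summit.ValiantsHypothesis.ValiantsHypothesis.Theorems.LacunarySymmetroidMatrixDescartes.NegSquaresTropical

open Finset
open scoped BigOperators

/-! ## The engine of T1: gross substitutes for valuated matroids (kernel) -/

/-- The Dress–Wenzel exchange axiom for a valuation `v` on a base family `ℬ` (we only ever evaluate `v` on `ℬ`). -/
def IsValuation {n : ℕ} (ℬ : Finset (Finset (Fin n))) (v : Finset (Fin n) → ℝ) : Prop :=
  ∀ B ∈ ℬ, ∀ B' ∈ ℬ, ∀ a ∈ B \ B', ∃ b ∈ B' \ B,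
    insert b (B.erase a) ∈ ℬ ∧ insert a (B'.erase b) ∈ ℬ ∧
      v B + v B' ≤ v (insert b (B.erase a)) + v (insert a (B'.erase b))

/-- Additive weight of a set. -/
def addW {n : ℕ} (c : Fin n → ℝ) (B : Finset (Fin n)) : ℝ := ∑ a ∈ B, c a

/-- `B` is the UNIQUE maximiser of `v + c` over `ℬ`. -/
def IsUniqueArgmax {n : ℕ} (ℬ : Finset (Finset (Fin n))) (v : Finset (Fin n) → ℝ) (c : Fin n → ℝ)
    (B : Finset (Fin n)) : Prop :=
  B ∈ ℬ ∧ ∀ B' ∈ ℬ, B' ≠ B → v B' + addW c B' < v B + addW c B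

/-- Raising the weights on `S` by `δ`. -/
def raise {n : ℕ} (c : Fin n → ℝ) (S : Finset (Fin n)) (δ : ℝ) : Fin n → ℝ :=
  fun a => c a + if a ∈ S then δ else 0

/-- Bookkeeping for `raise`/`addW` (gross-substitutes engine). [folklore] -/
theorem addW_exchange {n : ℕ} (c : Fin n → ℝ) {B : Finset (Fin n)} {a b : Fin n} (ha : a ∈ B) (hb : b ∉ B) :
    addW c (insert b (B.erase a)) = addW c B - c a + c b := by
  unfold addW
  have hb' : b ∉ B.erase a := fun h => hb (Finset.mem_of_mem_erase h)
  rw [Finset.sum_insert hb', Finset.sum_erase_eq_sub ha]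
  ring

/-- Bookkeeping for `raise`/`addW` (gross-substitutes engine). [folklore] -/
theorem raise_apply_of_mem {n : ℕ} (c : Fin n → ℝ) {S : Finset (Fin n)} (δ : ℝ) {a : Fin n} (h : a ∈ S) :
    raise c S δ a = c a + δ := by
  simp [raise, h]

/-- Bookkeeping for `raise`/`addW` (gross-substitutes engine). [folklore] -/
theorem raise_apply_of_not_mem {n : ℕ} (c : Fin n → ℝ) {S : Finset (Fin n)} (δ : ℝ) {a : Fin n} (h : a ∉ S) :
    raise c S δ a = c a := by
  simp [raise, h]

/-- Bookkeeping for `raise`/`addW` (gross-substitutes engine). [folklore] -/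
theorem raise_le {n : ℕ} (c : Fin n → ℝ) (S : Finset (Fin n)) {δ : ℝ} (hδ : 0 ≤ δ) (a : Fin n) :
    raise c S δ a ≤ c a + δ := by
  by_cases h : a ∈ S
  · simp [raise, h]
  · simp [raise, h, hδ]

/-- Bookkeeping for `raise`/`addW` (gross-substitutes engine). [folklore] -/
theorem le_raise {n : ℕ} (c : Fin n → ℝ) (S : Finset (Fin n)) {δ : ℝ} (hδ : 0 ≤ δ) (a : Fin n) :
    c a ≤ raise c S δ a := by
  by_cases h : a ∈ S
  · simp [raise, h, hδ]
  · simp [raise, h]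

/-- **Lemma A (upper-set move = gross substitutes), PROVED.**  For a valuation `v` on `ℬ`, weights `c`, a set `S` whose
weights are raised by `δ > 0`: the unique maximiser `B'` after the raise keeps every element of `S` that the unique
maximiser `B` before the raise had, and acquires no new element outside `S`. [val-idea-6 g7; Dress–Wenzel 1992,
Kelso–Crawford GS] -/
theorem upperSetMove {n : ℕ} {ℬ : Finset (Finset (Fin n))} {v : Finset (Fin n) → ℝ} (hv : IsValuation ℬ v)
    {c : Fin n → ℝ} {S : Finset (Fin n)} {δ : ℝ} (hδ : 0 < δ) {B B' : Finset (Fin n)}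
    (hB : IsUniqueArgmax ℬ v c B) (hB' : IsUniqueArgmax ℬ v (raise c S δ) B') :
    B ∩ S ⊆ B' ∧ B' \ S ⊆ B := by
  obtain ⟨hBmem, hBmax⟩ := hB
  obtain ⟨hB'mem, hB'max⟩ := hB'
  constructor
  · -- an element of `B ∩ S` missing from `B'` contradicts the exchange axiom
    intro a haS
    rw [Finset.mem_inter] at haS
    obtain ⟨haB, haSS⟩ := haS
    by_contra haB'
    obtain ⟨b, hb, h1, h2, hexc⟩ := hv B hBmem B' hB'mem a (Finset.mem_sdiff.mpr ⟨haB, haB'⟩)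
    rw [Finset.mem_sdiff] at hb
    obtain ⟨hbB', hbB⟩ := hb
    -- the two exchanged bases are different from the maximisers
    have hne1 : insert b (B.erase a) ≠ B := fun h => hbB (h ▸ Finset.mem_insert_self b _)
    have hne2 : insert a (B'.erase b) ≠ B' := fun h => haB' (h ▸ Finset.mem_insert_self a _)
    have lt1 := hBmax _ h1 hne1
    have lt2 := hB'max _ h2 hne2
    rw [addW_exchange c haB hbB] at lt1
    rw [addW_exchange (raise c S δ) hbB' haB'] at lt2
    have hra : raise c S δ a = c a + δ := raise_apply_of_mem c δ haSS
    have hrb : raise c S δ b ≤ c b + δ := raise_le c S hδ.le b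
    linarith
  · -- an element of `B' \ S` missing from `B` contradicts the exchange axiom (from the side of `B'`)
    intro b hbS
    rw [Finset.mem_sdiff] at hbS
    obtain ⟨hbB', hbnS⟩ := hbS
    by_contra hbB
    obtain ⟨a, ha, h1, h2, hexc⟩ := hv B' hB'mem B hBmem b (Finset.mem_sdiff.mpr ⟨hbB', hbB⟩)
    rw [Finset.mem_sdiff] at ha
    obtain ⟨haB, haB'⟩ := ha
    have hne1 : insert a (B'.erase b) ≠ B' := fun h => haB' (h ▸ Finset.mem_insert_self a _)
    have hne2 : insert b (B.erase a) ≠ B := fun h => hbB (h ▸ Finset.mem_insert_self b _)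
    have lt1 := hB'max _ h1 hne1
    have lt2 := hBmax _ h2 hne2
    rw [addW_exchange (raise c S δ) hbB' haB'] at lt1
    rw [addW_exchange c haB hbB] at lt2
    have hrb : raise c S δ b = c b := raise_apply_of_not_mem c δ hbnS
    have hra : c a ≤ raise c S δ a := le_raise c S hδ.le a
    linarith

/-- Counting form of Lemma A (the step iterated `K−1` times in the memo's Theorem T1): after the raise on `S` the unique
optimum has at least as many elements in `S` and at most as many outside `S`. -/
theorem card_mono_of_raise {n : ℕ} {ℬ : Finset (Finset (Fin n))} {v : Finset (Fin n) → ℝ} (hv : IsValuation ℬ v)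
    {c : Fin n → ℝ} {S : Finset (Fin n)} {δ : ℝ} (hδ : 0 < δ) {B B' : Finset (Fin n)}
    (hB : IsUniqueArgmax ℬ v c B) (hB' : IsUniqueArgmax ℬ v (raise c S δ) B') :
    (B ∩ S).card ≤ (B' ∩ S).card ∧ (B' \ S).card ≤ (B \ S).card := by
  obtain ⟨h1, h2⟩ := upperSetMove hv hδ hB hB'
  refine ⟨Finset.card_le_card ?_, Finset.card_le_card ?_⟩
  · intro a ha
    exact Finset.mem_inter.mpr ⟨h1 ha, (Finset.mem_inter.mp ha).2⟩
  · intro b hb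
    exact Finset.mem_sdiff.mpr ⟨h2 hb, (Finset.mem_sdiff.mp hb).2⟩

/-- **The per-step statement of T1 (kernel).**  If all members of `ℬ` have the same cardinality (bases of a matroid) and
`U` is NESTED with the raised set `S` (`U ⊆ S` or `S ⊆ U` — in T1 both are upper class-sets of the slope order), then the
number of optimum elements in `U` does not decrease under the raise.  Iterating over the chain of nested upper sets
`E_{>1} ⊇ E_{>2} ⊇ …` gives the monotonicity of every upper class count along `x` (memo §2). -/
theorem card_inter_mono_of_nested_raise {n : ℕ} {ℬ : Finset (Finset (Fin n))} {v : Finset (Fin n) → ℝ}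
    (hv : IsValuation ℬ v) {r : ℕ} (hcard : ∀ B ∈ ℬ, B.card = r)
    {c : Fin n → ℝ} {S U : Finset (Fin n)} (hnest : U ⊆ S ∨ S ⊆ U) {δ : ℝ} (hδ : 0 < δ) {B B' : Finset (Fin n)}
    (hB : IsUniqueArgmax ℬ v c B) (hB' : IsUniqueArgmax ℬ v (raise c S δ) B') :
    (B ∩ U).card ≤ (B' ∩ U).card := by
  obtain ⟨h1, h2⟩ := upperSetMove hv hδ hB hB'
  have hBc : B.card = r := hcard B hB.1
  have hB'c : B'.card = r := hcard B' hB'.1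
  rcases hnest with hUS | hSU
  · -- `U ⊆ S`: `B ∩ U ⊆ B' ∩ U` directly
    apply Finset.card_le_card
    intro a ha
    rw [Finset.mem_inter] at ha ⊢
    exact ⟨h1 (Finset.mem_inter.mpr ⟨ha.1, hUS ha.2⟩), ha.2⟩
  · -- `S ⊆ U`: `B' \ U ⊆ B \ U`, and both bases have `r` elements
    have hsub : B' \ U ⊆ B \ U := by
      intro b hb
      rw [Finset.mem_sdiff] at hb ⊢
      exact ⟨h2 (Finset.mem_sdiff.mpr ⟨hb.1, fun hbS => hb.2 (hSU hbS)⟩), hb.2⟩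
    have hle : (B' \ U).card ≤ (B \ U).card := Finset.card_le_card hsub
    have e1 : (B ∩ U).card + (B \ U).card = r := by rw [Finset.card_inter_add_card_sdiff, hBc]
    have e2 : (B' ∩ U).card + (B' \ U).card = r := by rw [Finset.card_inter_add_card_sdiff, hB'c]
    omega

end Summit.ValiantsHypothesis.ValiantsHypothesis.Theorems.LacunarySymmetroidMatrixDescartes.NegSquaresTropical
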